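import Mathlib
import Summits.Ventures.PercRepro2.Defs
import Summits.Ventures.PercRepro2.Graph
import Summits.Ventures.PercRepro2.OneColourSwitch
import Summits.Ventures.PercRepro2.RegionHubSign
import Summits.Ventures.PercRepro2.SideSwitch
import Summits.Ventures.PercRepro2.SideSwitchFibre
import Summits.Ventures.PercRepro2.SideSwitchMono
import Summits.Ventures.PercRepro2.SideSwitchM9
import Summits.Ventures.PercRepro2.SideSwitchClosed
import Summits.Ventures.PercRepro2.SideSwitchComps
import Summits.Ventures.PercRepro2.TermSwitchDefs
import Summits.Ventures.PercRepro2.TermSwitchFibre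
import Summits.Ventures.PercRepro2.TermSwitchCompsFibre
import Summits.Ventures.PercRepro2.TermSwitchMono
import Summits.Ventures.PercRepro2.TermSwitchM9
import Summits.Ventures.PercRepro2.TermSwitchRestrict
import Summits.Ventures.PercRepro2.TermSwitchHalfCube
import Summits.Ventures.PercRepro2.TermSwitchCornerCube

/-!
# The corner-free half-cube theorem (blind cell PercRepro2, p3 g38, 2026-08-29;
`proofs/P3-POCKETRK.md` §8‴) — part B, the terminal-set theorem

The half-cube theorem of `TermSwitchHalfCube` with ONE MORE condition of the same kind: for a
terminal set `H`, a fibre-invariant predicate `P`, a vertex `x₀` and a vertex set `X₁`,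
`Σ_{ω ∈ Sep_H ∩ DZero_H, P ω, x₀ ∈ K_H(ω), ∃ x ∈ X₁, x ∈ K_H(ω)} σ_pq(ω) ≤ 0`
(`dzeroSigmaSumHP_KH_exists_nonpos`).  On an `H`-fibre the second condition reads «some
component of a vertex of `X₁` is not switched» (`exists_mem_KH_assignC_iff`; void when `X₁`
contains a terminal), so the index set is the half-cube of `x₀` with the corner
`{T ⊇ S}` removed and the sum is non-positive by `corner_sum_nonpos` (part A) — or by the plain
half-cube when the component of `x₀` is one of the components of `X₁`
(`fibre_KH_exists_sum_nonpos`); the fibration and the outside-flip doubling are those of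
`TermSwitchHalfCube`.  With `x₀` a vertex of the linking free block and `X₁` the joined blocks
this is the inequality `(C3-B″)` of `proofs/P3-POCKETRK.md` §8‴ — the `s(𝔑) = 0` case of the
linking-free-block theorem.  Own work; std axioms.
-/

namespace Summit.Ventures.PercRepro2

namespace TermSwitch

open Finset Classical RegionHub OneColourSwitch SideSwitch

variable {V : Type*} {E : Type*}

section Count

variable [Fintype V] [DecidableEq V] [Fintype E] [DecidableEq E]

variable {ends : E → Sym2 V}

omit [Fintype E] [DecidableEq E] in
/-- The components of the vertices of `X₁` (in the sided set of `ρ`) are components of `ρ`. -/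
lemma compsOf_subset {H : Set V} {ρ : Config E} {X₁ : Set V} :
    ((A0H ends H ρ).filter (fun x => x ∈ X₁)).image (compIn ends (↑(A0H ends H ρ) : Set V)) ⊆
      compsH ends H ρ := by
  intro C hC
  obtain ⟨x, hx, rfl⟩ := Finset.mem_image.1 hC
  exact Finset.mem_image.2 ⟨x, (Finset.mem_filter.1 hx).1, rfl⟩

/-- When no vertex of `X₁` is a terminal, «some vertex of `X₁` is `Y`-reached at the assignment
`T` of `ρ`» means «some component of a vertex of `X₁` is not switched». -/
lemma exists_mem_KH_assignC_iff {p q : V} {H : Set V} {ρ : Config E}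
    (hρ : ρ ∈ RepH ends p q H) {T : Finset (Finset V)} (hT : T ⊆ compsH ends H ρ)
    {X₁ : Set V} (hX : ∀ x ∈ X₁, x ∉ H) :
    (∃ x ∈ X₁, x ∈ KH ends H (assignC ends T ρ)) ↔
      ¬ ((A0H ends H ρ).filter (fun x => x ∈ X₁)).image
        (compIn ends (↑(A0H ends H ρ) : Set V)) ⊆ T := by
  rw [KH_assignC_of_mem_RepH hρ hT]
  constructor
  · rintro ⟨x, hxX, hxK, hxT⟩ hsub
    have hxA : x ∈ A0H ends H ρ := mem_A0H.2 ⟨Or.inl hxK, hX x hxX⟩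
    have hC : compIn ends (↑(A0H ends H ρ) : Set V) x ∈
        ((A0H ends H ρ).filter (fun x => x ∈ X₁)).image
          (compIn ends (↑(A0H ends H ρ) : Set V)) :=
      Finset.mem_image.2 ⟨x, Finset.mem_filter.2 ⟨hxA, hxX⟩, rfl⟩
    exact hxT (Finset.mem_coe.2 ((mem_unionT_iff_compIn_mem hT x).2 (hsub hC)))
  · intro hsub
    obtain ⟨C, hC, hCT⟩ := Finset.not_subset.1 hsub
    obtain ⟨x, hx, rfl⟩ := Finset.mem_image.1 hC
    obtain ⟨hxA, hxX⟩ := Finset.mem_filter.1 hx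
    refine ⟨x, hxX, A0H_subset_KH_of_mem_RepH hρ hxA, ?_⟩
    intro hxT
    exact hCT ((mem_unionT_iff_compIn_mem hT x).1 (Finset.mem_coe.1 hxT))

/-- The per-representative sum with the two conditions «`x₀ ∈ K_H(ρ_T)`» and «some vertex of
`X₁` is in `K_H(ρ_T)`» is non-positive. -/
lemma fibre_KH_exists_sum_nonpos {p q : V} {H : Set V} {ρ : Config E} (hρ : ρ ∈ RepH ends p q H)
    (x₀ : V) (X₁ : Set V) :
    ∑ T ∈ (compsH ends H ρ).powerset,
      (if x₀ ∈ KH ends H (assignC ends T ρ) ∧ (∃ x ∈ X₁, x ∈ KH ends H (assignC ends T ρ)) then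
        sigma ends (assignC ends T ρ) p q +
          sigma ends (assignC ends T (flipOH ends H ρ)) p q else 0) ≤ 0 := by
  set A := compsH ends H ρ with hA
  -- a terminal in `X₁`: the second condition is void
  by_cases hXH : ∃ x ∈ X₁, x ∈ H
  · obtain ⟨x, hxX, hxH⟩ := hXH
    have hall : ∀ T ∈ A.powerset, (∃ x ∈ X₁, x ∈ KH ends H (assignC ends T ρ)) :=
      fun T _ => ⟨x, hxX, mem_KH_of_mem hxH _⟩
    have := fibre_KH_sum_nonpos (p := p) (q := q) hρ x₀
    refine le_of_eq_of_le (Finset.sum_congr rfl (fun T hT => ?_)) this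
    by_cases hK : x₀ ∈ KH ends H (assignC ends T ρ)
    · rw [if_pos ⟨hK, hall T hT⟩, if_pos hK]
    · rw [if_neg (fun h => hK h.1), if_neg hK]
  · have hX : ∀ x ∈ X₁, x ∉ H := fun x hx hxH => hXH ⟨x, hx, hxH⟩
    set S := ((A0H ends H ρ).filter (fun x => x ∈ X₁)).image
      (compIn ends (↑(A0H ends H ρ) : Set V)) with hSdef
    have hSA : S ⊆ A := compsOf_subset
    have hcond2 : ∀ T ∈ A.powerset,
        ((∃ x ∈ X₁, x ∈ KH ends H (assignC ends T ρ)) ↔ ¬ S ⊆ T) :=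
      fun T hT => exists_mem_KH_assignC_iff hρ (Finset.mem_powerset.1 hT) hX
    by_cases hx₀ : x₀ ∈ KH ends H ρ
    · by_cases hxH : x₀ ∈ H
      · -- the full cube minus the corner: `R = ∅`
        have hall : ∀ T ∈ A.powerset, x₀ ∈ KH ends H (assignC ends T ρ) := fun T _ =>
          mem_KH_of_mem hxH _
        rw [Finset.sum_congr rfl (fun T hT => by
          rw [if_congr (and_iff_right (hall T hT) |>.trans (hcond2 T hT)) rfl rfl]),
          ← Finset.sum_filter]
        have hS' : S ⊆ A \ (∅ : Finset (Finset V)) := by rw [Finset.sdiff_empty]; exact hSA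
        have := corner_sum_nonpos (p := p) (q := q) hρ (Finset.empty_subset A) hS'
        rw [Finset.sdiff_empty] at this
        exact this
      · have hxA : x₀ ∈ A0H ends H ρ := mem_A0H.2 ⟨Or.inl hx₀, hxH⟩
        set C := compIn ends (↑(A0H ends H ρ) : Set V) x₀ with hCdef
        have hC : C ∈ A := Finset.mem_image.2 ⟨x₀, hxA, rfl⟩
        have hcond1 : ∀ T ∈ A.powerset, (x₀ ∈ KH ends H (assignC ends T ρ) ↔ C ∉ T) := by
          intro T hT
          have hTA : T ⊆ A := Finset.mem_powerset.1 hT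
          rw [KH_assignC_of_mem_RepH hρ hTA, Set.mem_sdiff, Finset.mem_coe,
            mem_unionT_iff_compIn_mem hTA x₀]
          exact ⟨fun h => h.2, fun h => ⟨hx₀, h⟩⟩
        rw [Finset.sum_congr rfl (fun T hT => by
          rw [if_congr (and_congr (hcond1 T hT) (hcond2 T hT)) rfl rfl]),
          ← Finset.sum_filter]
        by_cases hCS : C ∈ S
        · -- the corner condition is implied by the half-cube condition
          have hfilt : A.powerset.filter (fun T => C ∉ T ∧ ¬ S ⊆ T) =
              (A.erase C).powerset := by
            ext T
            simp only [Finset.mem_filter, Finset.mem_powerset, Finset.subset_erase]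
            constructor
            · rintro ⟨hTA, hCT, _⟩; exact ⟨hTA, hCT⟩
            · rintro ⟨hTA, hCT⟩; exact ⟨hTA, hCT, fun hsub => hCT (hsub hCS)⟩
          rw [hfilt]
          exact halfcube_sum_nonpos hρ hC
        · have hfilt : A.powerset.filter (fun T => C ∉ T ∧ ¬ S ⊆ T) =
              (A \ {C}).powerset.filter (fun T => ¬ S ⊆ T) := by
            ext T
            simp only [Finset.mem_filter, Finset.mem_powerset, Finset.subset_sdiff,
              Finset.disjoint_singleton_right]
            constructor
            · rintro ⟨hTA, hCT, hST⟩; exact ⟨⟨hTA, hCT⟩, hST⟩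
            · rintro ⟨⟨hTA, hCT⟩, hST⟩; exact ⟨hTA, hCT, hST⟩
          rw [hfilt]
          have hRA : ({C} : Finset (Finset V)) ⊆ A := Finset.singleton_subset_iff.2 hC
          have hS' : S ⊆ A \ {C} := by
            intro D hD
            exact Finset.mem_sdiff.2 ⟨hSA hD, fun hDC => hCS (Finset.mem_singleton.1 hDC ▸ hD)⟩
          exact corner_sum_nonpos hρ hRA hS'
    · -- empty: `x₀` is never in the `Y`-world along the fibre
      have hnone : ∀ T ∈ A.powerset, x₀ ∉ KH ends H (assignC ends T ρ) := by
        intro T hT h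
        rw [KH_assignC_of_mem_RepH hρ (Finset.mem_powerset.1 hT)] at h
        exact hx₀ h.1
      rw [Finset.sum_congr rfl (fun T hT => if_neg (fun h => hnone T hT h.1))]
      simp

/-- **The corner-free half-cube theorem**: for a fibre-invariant predicate `P`, a vertex `x₀`
and a vertex set `X₁`, `Σ_{ω ∈ Sep_H ∩ DZero_H, P ω, x₀ ∈ K_H(ω), ∃ x ∈ X₁, x ∈ K_H(ω)} σ_pq(ω) ≤ 0`. -/
theorem dzeroSigmaSumHP_KH_exists_nonpos (p q : V) (H : Set V) (P : Config E → Prop)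
    (hPa : ∀ ρ ∈ RepH ends p q H, ∀ T ⊆ compsH ends H ρ, (P (assignC ends T ρ) ↔ P ρ))
    (hPO : ∀ ρ ∈ RepH ends p q H, (P (flipOH ends H ρ) ↔ P ρ)) (x₀ : V) (X₁ : Set V) :
    (∑ ω : Config E, if sepH ends p q H ω ∧ DZeroH ends H ω ∧ P ω ∧ x₀ ∈ KH ends H ω ∧
      (∃ x ∈ X₁, x ∈ KH ends H ω) then sigma ends ω p q else 0) ≤ 0 := by
  set S₀ : ℤ := ∑ ω : Config E, if sepH ends p q H ω ∧ DZeroH ends H ω ∧ P ω ∧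
    x₀ ∈ KH ends H ω ∧ (∃ x ∈ X₁, x ∈ KH ends H ω) then sigma ends ω p q else 0 with hS₀
  -- the fibration, with `P` pulled out of the inner sum
  have hsum : S₀ =
      ∑ ρ ∈ RepH ends p q H, if P ρ then ∑ T ∈ (compsH ends H ρ).powerset,
        (if x₀ ∈ KH ends H (assignC ends T ρ) ∧
            (∃ x ∈ X₁, x ∈ KH ends H (assignC ends T ρ)) then
          sigma ends (assignC ends T ρ) p q else 0)
      else 0 := by
    have h1 : S₀ =
        ∑ ω ∈ DZeroSetH ends p q H,
          if P ω ∧ x₀ ∈ KH ends H ω ∧ (∃ x ∈ X₁, x ∈ KH ends H ω) then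
            sigma ends ω p q else 0 := by
      have hset : DZeroSetH ends p q H =
          univ.filter (fun ω => sepH ends p q H ω ∧ DZeroH ends H ω) := by
        ext ω; simp [DZeroSetH, SepSetH]
      rw [hset, Finset.sum_filter, hS₀]
      refine Finset.sum_congr rfl (fun ω _ => ?_)
      by_cases h1 : sepH ends p q H ω ∧ DZeroH ends H ω
      · by_cases h2 : P ω ∧ x₀ ∈ KH ends H ω ∧ (∃ x ∈ X₁, x ∈ KH ends H ω)
        · rw [if_pos ⟨h1.1, h1.2, h2.1, h2.2.1, h2.2.2⟩, if_pos h1, if_pos h2]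
        · rw [if_neg (fun h => h2 ⟨h.2.2.1, h.2.2.2.1, h.2.2.2.2⟩), if_pos h1, if_neg h2]
      · rw [if_neg (fun h => h1 ⟨h.1, h.2.1⟩), if_neg h1]
    rw [h1, sum_dzeroH_eq_sum_repH_comps (fun ω =>
      if P ω ∧ x₀ ∈ KH ends H ω ∧ (∃ x ∈ X₁, x ∈ KH ends H ω) then sigma ends ω p q else 0)]
    refine Finset.sum_congr rfl (fun ρ hρ => ?_)
    by_cases hP : P ρ
    · rw [if_pos hP]
      refine Finset.sum_congr rfl (fun T hT => ?_)
      have hPT := (hPa ρ hρ T (Finset.mem_powerset.1 hT)).2 hP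
      by_cases hK : x₀ ∈ KH ends H (assignC ends T ρ) ∧
          (∃ x ∈ X₁, x ∈ KH ends H (assignC ends T ρ))
      · rw [if_pos ⟨hPT, hK.1, hK.2⟩, if_pos hK]
      · rw [if_neg (fun h => hK ⟨h.2.1, h.2.2⟩), if_neg hK]
    · rw [if_neg hP]
      refine Finset.sum_eq_zero (fun T hT => ?_)
      rw [if_neg (fun h => hP ((hPa ρ hρ T (Finset.mem_powerset.1 hT)).1 h.1))]
  -- the same sum through the outside flip of the representatives
  have hsumO : (∑ ρ ∈ RepH ends p q H, if P ρ then ∑ T ∈ (compsH ends H ρ).powerset,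
        (if x₀ ∈ KH ends H (assignC ends T ρ) ∧
            (∃ x ∈ X₁, x ∈ KH ends H (assignC ends T ρ)) then
          sigma ends (assignC ends T ρ) p q else 0) else 0) =
      ∑ ρ ∈ RepH ends p q H, if P ρ then ∑ T ∈ (compsH ends H ρ).powerset,
        (if x₀ ∈ KH ends H (assignC ends T ρ) ∧
            (∃ x ∈ X₁, x ∈ KH ends H (assignC ends T ρ)) then
          sigma ends (assignC ends T (flipOH ends H ρ)) p q else 0) else 0 := by
    symm
    refine Finset.sum_nbij' (fun ρ => flipOH ends H ρ) (fun ρ => flipOH ends H ρ)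
      (fun ρ hρ => flipOH_mem_RepH hρ) (fun ρ hρ => flipOH_mem_RepH hρ)
      (fun ρ _ => flipOH_flipOH H ρ) (fun ρ _ => flipOH_flipOH H ρ) ?_
    intro ρ hρ
    rw [compsH_flipOH]
    by_cases hP : P ρ
    · rw [if_pos hP, if_pos ((hPO ρ hρ).2 hP)]
      refine Finset.sum_congr rfl (fun T hT => ?_)
      rw [KH_assignC_flipOH (Finset.mem_powerset.1 hT)]
    · rw [if_neg hP, if_neg (fun h => hP ((hPO ρ hρ).1 h))]
  have hkey : ∀ ρ ∈ RepH ends p q H,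
      (if P ρ then ∑ T ∈ (compsH ends H ρ).powerset,
        (if x₀ ∈ KH ends H (assignC ends T ρ) ∧
            (∃ x ∈ X₁, x ∈ KH ends H (assignC ends T ρ)) then
          sigma ends (assignC ends T ρ) p q +
            sigma ends (assignC ends T (flipOH ends H ρ)) p q else 0) else 0) ≤ 0 := by
    intro ρ hρ
    by_cases hP : P ρ
    · rw [if_pos hP]; exact fibre_KH_exists_sum_nonpos hρ x₀ X₁
    · rw [if_neg hP]
  have htwice : 2 * S₀ ≤ 0 := by
    calc 2 * S₀ = S₀ + S₀ := by ring
      _ = (∑ ρ ∈ RepH ends p q H, if P ρ then ∑ T ∈ (compsH ends H ρ).powerset,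
            (if x₀ ∈ KH ends H (assignC ends T ρ) ∧
                (∃ x ∈ X₁, x ∈ KH ends H (assignC ends T ρ)) then
              sigma ends (assignC ends T ρ) p q else 0) else 0) +
          ∑ ρ ∈ RepH ends p q H, if P ρ then ∑ T ∈ (compsH ends H ρ).powerset,
            (if x₀ ∈ KH ends H (assignC ends T ρ) ∧
                (∃ x ∈ X₁, x ∈ KH ends H (assignC ends T ρ)) then
              sigma ends (assignC ends T (flipOH ends H ρ)) p q else 0) else 0 := by
          rw [← hsumO, ← hsum]
      _ = ∑ ρ ∈ RepH ends p q H, if P ρ then ∑ T ∈ (compsH ends H ρ).powerset,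
            (if x₀ ∈ KH ends H (assignC ends T ρ) ∧
                (∃ x ∈ X₁, x ∈ KH ends H (assignC ends T ρ)) then
              sigma ends (assignC ends T ρ) p q +
                sigma ends (assignC ends T (flipOH ends H ρ)) p q else 0) else 0 := by
          rw [← Finset.sum_add_distrib]
          refine Finset.sum_congr rfl (fun ρ _ => ?_)
          by_cases hP : P ρ
          · simp only [if_pos hP]
            rw [← Finset.sum_add_distrib]
            refine Finset.sum_congr rfl (fun T _ => ?_)
            by_cases hK : x₀ ∈ KH ends H (assignC ends T ρ) ∧
                (∃ x ∈ X₁, x ∈ KH ends H (assignC ends T ρ))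
            · simp only [if_pos hK]
            · simp only [if_neg hK, add_zero]
          · simp only [if_neg hP, add_zero]
      _ ≤ 0 := Finset.sum_nonpos (fun ρ hρ => hkey ρ hρ)
  linarith

end Count

end TermSwitch

end Summit.Ventures.PercRepro2
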